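import Literature.NumberTheory.Automorphic.GL2AdelicWeightVectors
import Literature.NumberTheory.Automorphic.AutomorphicRepsGLShiftRealisation
import Literature.NumberTheory.Automorphic.AutomorphicRepsGLCuspidalUnitaryHolds
import Literature.NumberTheory.Automorphic.AutomorphicRepsGL2WeightOneHeckeEigenform
import Literature.NumberTheory.Automorphic.NewformAdelisationDescentHolomorphy
import Literature.NumberTheory.Automorphic.GL2NewvectorExistence
import Literature.NumberTheory.Automorphic.ReciprocityGLnPotentialModularityTateProofs
import Literature.NumberTheory.Automorphic.EllipticCurveRatCuspidalRepProofs
import Literature.NumberTheory.Automorphic.AutomorphicRepsGLSatakeFlathProofs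
import Literature.NumberTheory.Automorphic.AutomorphicRepCentralCharacter
import Literature.NumberTheory.GaloisRepresentations.HeckeCharacterWeakApproximation
import Literature.NumberTheory.Automorphic.BCDTModularityModPProofs
import Literature.NumberTheory.EllipticCurves.Newforms
import Literature.NumberTheory.EllipticCurves.CuspFormLFunction
import HarnessLib

/-!
# Stub-ideation k = 2, GENERATION 4 (home family 2 = RESHAPE) for `stub_liftFive` of crux
# `FreyModularity` (stmt-ABC-11340, route ABC/DefiniteXi, line `Lines/Sketch.lean`)

Generation 3 (`STUB_IDEAS_stub_liftFive_2g3.lean`, rc 0, ONE sorry) left Plan A (carrier reshape to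
`FLS2015_theorem2` at `K = ℚ`, `p = 5`) kernel-checked modulo the single named debt

  **D4a** `exists_isNewform0_of_isAutomorphicOfWeightZero_rat`:
  a weight-zero cuspidal `π` of `GL₂(𝔸_ℚ)` with Hecke polynomials `X² - a_w(E) X + q_w` off `Δ(E)`
  comes from a newform `g ∈ S₂(Γ₀(M))` with `a_q(g) = a_q(E ⊗ ℚ)` off `M · R`.

Generation 4 RESHAPES D4a into one-cycle helpers by porting the tree's PROVED weight-one dictionary
`π ↦ f_π` (`IsOfWeightOne.exists_isNewform1_of_fixed`, `…CleanModel`, `GL2(Adelic)WeightVectors`,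
`…HeckeEigenform`) from Harish-Chandra parameter `{0,0}` / odd sign / weight `1` to parameter
`{1/2,-1/2}` / even sign / weight `2`:

* PROVED here: parity (`even_of_isWeightVec`), **P3 weight-two extraction at Casimir `0`**
  (`exists_isWeightVec_two_lowerFun_eq_zero(_of_finite)`, the one genuinely new archimedean step,
  with the rigidity hypothesis `hrigid`), `hasArchWeight_of_isWeightVec` (all `m`), **P0 clean model**,
  `HasWeightZero.hasArchParameter_weightTwo`, **P1 Satake feed**, **P2 even sign from the central
  character**, P2′, **P3-adelic**, **P9** (`a_w(E) = a_p(E ⊗ ℚ)` off `R = |Δ|`), and the composition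
  **`D4a_of_helpers : D4a`**.
* SORRIED one-cycle helpers (each a port of a named tree lemma, `1 ↦ 2`): P4a, P4b, P4 (rigidity of
  weight-`0` vectors), P5a/b/c (Hecke ports), P6 (descent to `S₂(Γ₁(N))`), P7 (newform of minimal
  level), P8 (`χ = 1`, `Γ₀`-descent, `a_p`).

Nothing here needs an `R = T` theorem, Serre's conjecture or `CDT_theorem_7_2_2`.
-/

-- Mathlib idiom (Mathlib/Algebra/Lie/OfAssociative.lean); needed to mention Lie subalgebras of matrix algebras
attribute [local instance 100] LieRing.ofAssociativeRing

set_option linter.dupNamespace false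
set_option linter.unusedVariables false
set_option linter.unusedSectionVars false

noncomputable section

open scoped MatrixGroups Matrix NumberField ModularForm UpperHalfPlane Polynomial Classical
open NumberField NumberField.mixedEmbedding IsDedekindDomain Polynomial Filter
open Literature.NumberTheory.Automorphic Literature.NumberTheory.GaloisRepresentations
open Literature.NumberTheory.EllipticCurves Literature.NumberTheory.EllipticCurves.ModularForms
open CongruenceSubgroup Rat.HeightOneSpectrum GL2Real AutomorphicRepData

namespace Summit.ABC.ABC.Cruxes.FreyModularity.StubIdeas.LiftFive2g4

attribute [local instance] neZero_natGenerator

/-- **D4a verbatim** (the one residual debt of gen-3 Plan A; `STUB_IDEAS_stub_liftFive_2g3.lean`,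
`exists_isNewform0_of_isAutomorphicOfWeightZero_rat`). -/
def D4a : Prop :=
  ∀ (E : WeierstrassCurve (𝓞 ℚ)), E.Δ ≠ 0 → IsAutomorphicOfWeightZero E →
    ∃ (M : ℕ) (_ : NeZero M) (g : CuspForm (Gamma0 M) 2), IsNewform0 g ∧
      ∃ (R : ℕ) (_ : NeZero R), ∀ q : ℕ, q.Prime → ¬ q ∣ M * R →
        cuspCoeff g q = ((E.baseChange ℚ).LFunction q : ℂ)

/-- The Harish-Chandra parameter `s₁ = (k-1)/2` of weight `k = 2`, in the syntactic form produced by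
`map_a_weightZeroInfinityType_two`. -/
def sOne : ℂ := (((2 : ℤ) : ℂ) - 1) / 2

/-- `s₂ = (1-k)/2`, `k = 2`. -/
def sTwo : ℂ := (1 - ((2 : ℤ) : ℂ)) / 2

/-- `s₁ + s₂ = 0` (`Z` acts by `0`: trivial central character at infinity). -/
theorem sOne_add_sTwo : sOne + sTwo = 0 := by
  unfold sOne sTwo; push_cast; ring

/-- `s₁² + s₂² - ½ = 0` (`C = 0`, hence Casimir `Ω = 0`: the infinitesimal character of `D₂`). -/
theorem sOne_sq_add_sTwo_sq : sOne ^ 2 + sTwo ^ 2 - 1 / 2 = 0 := by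
  unfold sOne sTwo; push_cast; ring

/-! ## Archimedean layer (abstract `G`, homomorphism `ι : GL₂(ℝ) → G`) -/

section Arch

variable {G : Type*} [Group G] {ι : (RealMatrixGroup.gl ℝ (Fin 2)).carrier →* G} {m : ℤ}
  {φ : G → ℂ}

/-- **Parity (even)**: if `k_π = -1` acts trivially on a non-zero vector of weight `m`, then `m` is
even (mirror of `IsWeightVec.odd`; Gelbart 1997, proof of Prop. 4.2). PROVED. -/
theorem even_of_isWeightVec (hφ : IsWeightVec ι m φ) (hpos : ∀ g, φ (g * ι (rotK Real.pi)) = φ g)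
    (h0 : φ ≠ 0) : Even m := by
  obtain ⟨g, hg⟩ : ∃ g, φ g ≠ 0 := Function.ne_iff.1 h0
  have h1 : (-1 : ℂ) ^ m * φ g = φ g := by rw [← hφ.apply_mul_rotK_pi g, hpos g]
  have h2 : (-1 : ℂ) ^ m = 1 := by
    have h3 : ((-1 : ℂ) ^ m - 1) * φ g = 0 := by linear_combination h1
    have h4 : (-1 : ℂ) ^ m - 1 = 0 := (mul_eq_zero.1 h3).resolve_right hg
    linear_combination h4
  rcases Int.even_or_odd m with he | ho
  · exact he
  · rw [ho.neg_one_zpow] at h2; norm_num at h2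

/-- **P3 (PROVED) — weight-TWO extraction at Casimir `0` from an even `K`-type.** Port of
`GL2Real.exists_isWeightVec_one_lowerFun_eq_zero` from (`Ω = -1/2`, odd) to (`Ω = 0`, even): on
weight `m`, `X̄ X = (2·0 - m² + 2m) = -m(m-2)` (`raiseFun_lowerFun_of_isWeightVec`), so from an even
weight `2j + 2 ≥ 4` (after `r(ε)` if `m < 0`) `X` descends non-trivially to weight `2`; at weight
`2`, either `X u = 0` (done) or `X u ≠ 0` has weight `0`; a weight-`0` vector `w ≠ 0` with
`X w ≠ 0` gives `ε(X w)` of weight `2` killed by `X` (`archTranslate_epsK_raiseFun`, `X̄ X w = 0`);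
if `X w = 0` the same applies to `r(ε) w` unless also `X (r(ε) w) = ε (X̄ w) = 0`, i.e. `w` is
killed by `X` and `X̄` — the case excluded by `hrigid` (for cusp forms such `w` are constants, P4).
[cite: Bump1997, Exercise 2.1.7] [cite: Gelbart1975, p. 61] -/
theorem exists_isWeightVec_two_lowerFun_eq_zero {W₁ : Submodule ℂ (G → ℂ)}
    (hsmooth : ∀ φ ∈ W₁, IsArchSmooth ι φ)
    (heps : ∀ φ ∈ W₁, archTranslate ι epsK φ ∈ W₁)
    (hlie : ∀ (X : Matrix (Fin 2) (Fin 2) ℝ), ∀ φ ∈ W₁, lieDeriv ι (toLie X) φ ∈ W₁)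
    (hcas : ∀ φ ∈ W₁, casimirFun ι φ = (0 : ℂ) • φ)
    (hrigid : ∀ φ ∈ W₁, IsWeightVec ι 0 φ → lowerFun ι φ = 0 → raiseFun ι φ = 0 → φ = 0)
    {m : ℤ} (hm : Even m) {v : G → ℂ} (hvW : v ∈ W₁) (hv0 : v ≠ 0) (hv : IsWeightVec ι m v) :
    ∃ ψ ∈ W₁, ψ ≠ 0 ∧ IsWeightVec ι 2 ψ ∧ lowerFun ι ψ = 0 := by
  -- membership of `X φ` in `W₁`
  have hlow : ∀ φ ∈ W₁, lowerFun ι φ ∈ W₁ := fun φ hφ =>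
    W₁.sub_mem (hlie _ φ hφ) (W₁.smul_mem _ (W₁.add_mem (hlie _ φ hφ) (hlie _ φ hφ)))
  -- `r(ε)` is injective
  have heps0 : ∀ φ : G → ℂ, archTranslate ι epsK φ = 0 → φ = 0 := fun φ h => by
    have h2 : archTranslate ι epsK (archTranslate ι epsK φ) = φ := by
      rw [← Module.End.mul_apply, ← map_mul, epsK_mul_epsK, map_one, Module.End.one_apply]
    rw [← h2, h, map_zero]
  -- Case A: a weight-zero vector NOT killed by `X`: `ε (X u)` has weight `2` and is killed by `X`
  have caseA : ∀ u ∈ W₁, IsWeightVec ι 0 u → lowerFun ι u ≠ 0 →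
      ∃ ψ ∈ W₁, ψ ≠ 0 ∧ IsWeightVec ι 2 ψ ∧ lowerFun ι ψ = 0 := by
    intro u huW hu hL
    have hwW := hlow u huW
    have hww : IsWeightVec ι (-2) (lowerFun ι u) := by
      have h := hu.weight_lowerFun (hsmooth u huW); norm_num at h; exact h
    have hRw : raiseFun ι (lowerFun ι u) = 0 := by
      rw [raiseFun_lowerFun_of_isWeightVec (hsmooth u huW) hu (hcas u huW)]
      norm_num
    refine ⟨archTranslate ι epsK (lowerFun ι u), heps _ hwW, fun h => hL (heps0 _ h), ?_, ?_⟩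
    · have h := hww.archTranslate_epsK; norm_num at h; exact h
    · rw [← archTranslate_epsK_raiseFun (hsmooth _ (heps _ hwW)), hRw, map_zero]
  -- the weight-zero case: `u` or `r(ε) u` is in Case A, unless `u` is killed by `X` and `X̄`
  have zero : ∀ u ∈ W₁, u ≠ 0 → IsWeightVec ι 0 u →
      ∃ ψ ∈ W₁, ψ ≠ 0 ∧ IsWeightVec ι 2 ψ ∧ lowerFun ι ψ = 0 := by
    intro u huW hu0 hu
    by_cases hL : lowerFun ι u = 0
    · have hu'W := heps u huW
      have hu' : IsWeightVec ι 0 (archTranslate ι epsK u) := by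
        have h := hu.archTranslate_epsK; norm_num at h; exact h
      by_cases hL' : lowerFun ι (archTranslate ι epsK u) = 0
      · exfalso
        have hR : raiseFun ι u = 0 := by
          apply heps0
          rw [archTranslate_epsK_raiseFun (hsmooth _ hu'W), hL']
        exact hu0 (hrigid u huW hu hL hR)
      · exact caseA _ hu'W hu' hL'
    · exact caseA u huW hu hL
  -- the positive even case `m = 2j + 2`, by induction on `j`
  have pos : ∀ (j : ℕ) (u : G → ℂ), u ∈ W₁ → u ≠ 0 → IsWeightVec ι (2 * (j : ℤ) + 2) u →
      ∃ ψ ∈ W₁, ψ ≠ 0 ∧ IsWeightVec ι 2 ψ ∧ lowerFun ι ψ = 0 := by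
    intro j
    induction j with
    | zero =>
      intro u huW hu0 hu
      simp only [Nat.cast_zero, mul_zero, zero_add] at hu
      by_cases hL : lowerFun ι u = 0
      · exact ⟨u, huW, hu0, hu, hL⟩
      · have hww : IsWeightVec ι 0 (lowerFun ι u) := by
          have h := hu.weight_lowerFun (hsmooth u huW); norm_num at h; exact h
        exact zero (lowerFun ι u) (hlow u huW) hL hww
    | succ j ih =>
      intro u huW hu0 hu
      have hwW := hlow u huW
      have hww : IsWeightVec ι (2 * (j : ℤ) + 2) (lowerFun ι u) := by
        have h := hu.weight_lowerFun (hsmooth u huW)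
        push_cast at h ⊢
        convert h using 2
        ring
      have hw0 : lowerFun ι u ≠ 0 := by
        intro h0
        have hRL := raiseFun_lowerFun_of_isWeightVec (hsmooth u huW) hu (hcas u huW)
        rw [h0, GL2Real.raiseFun_zero] at hRL
        rcases smul_eq_zero.1 hRL.symm with hc0 | hu00
        · push_cast at hc0
          have h' : (2 * (j : ℂ) + 4) * (2 * (j : ℂ) + 2) = 0 := by linear_combination -hc0
          have hne : (2 * (j : ℂ) + 4) * (2 * (j : ℂ) + 2) ≠ 0 := by
            exact_mod_cast (show (2 * j + 4) * (2 * j + 2) ≠ 0 by positivity)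
          exact hne h'
        · exact hu0 hu00
      exact ih (lowerFun ι u) hwW hw0 hww
  -- reduce to the cases
  obtain ⟨k, rfl⟩ := hm
  rcases lt_trichotomy k 0 with hk | rfl | hk
  · -- negative weight: apply `r(ε)`
    have hv' := hv.archTranslate_epsK
    obtain ⟨j, hj⟩ : ∃ j : ℕ, (j : ℤ) = -k - 1 := ⟨(-k - 1).toNat, Int.toNat_of_nonneg (by omega)⟩
    have hk' : -(k + k) = 2 * (j : ℤ) + 2 := by omega
    rw [hk'] at hv'
    exact pos j _ (heps v hvW) (fun h => hv0 (heps0 v h)) hv'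
  · simp only [add_zero] at hv
    exact zero v hvW hv0 hv
  · obtain ⟨j, hj⟩ : ∃ j : ℕ, (j : ℤ) = k - 1 := ⟨(k - 1).toNat, Int.toNat_of_nonneg (by omega)⟩
    have hk' : k + k = 2 * (j : ℤ) + 2 := by omega
    rw [hk'] at hv
    exact pos j v hvW hv0 hv

/-- **P3, assembled form (PROVED)**: a non-zero `SO(2)`-finite vector on which `k_π` acts
trivially, in a stable space with `Ω = 0` and no non-zero weight-`0` vector killed by `X`, `X̄`,
yields a non-zero weight-`2` vector killed by `X` (`exists_isWeightVec_mem_of_finiteDimensional`,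
`even_of_isWeightVec`, `exists_isWeightVec_two_lowerFun_eq_zero`). -/
theorem exists_isWeightVec_two_lowerFun_eq_zero_of_finite {W₁ : Submodule ℂ (G → ℂ)}
    (hsmooth : ∀ φ ∈ W₁, IsArchSmooth ι φ)
    (heps : ∀ φ ∈ W₁, archTranslate ι epsK φ ∈ W₁)
    (hlie : ∀ (X : Matrix (Fin 2) (Fin 2) ℝ), ∀ φ ∈ W₁, lieDeriv ι (toLie X) φ ∈ W₁)
    (hcas : ∀ φ ∈ W₁, casimirFun ι φ = (0 : ℂ) • φ)
    (hpos : ∀ φ ∈ W₁, ∀ g, φ (g * ι (rotK Real.pi)) = φ g)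
    (hrigid : ∀ φ ∈ W₁, IsWeightVec ι 0 φ → lowerFun ι φ = 0 → raiseFun ι φ = 0 → φ = 0)
    {φ : G → ℂ} (hφ0 : φ ≠ 0)
    (hfin : ∃ V : Submodule ℂ (G → ℂ), FiniteDimensional ℂ V ∧ φ ∈ V ∧ V ≤ W₁ ∧
      ∀ θ : ℝ, ∀ ψ ∈ V, archTranslate ι (rotK θ) ψ ∈ V) :
    ∃ ψ ∈ W₁, ψ ≠ 0 ∧ IsWeightVec ι 2 ψ ∧ lowerFun ι ψ = 0 := by
  obtain ⟨V, hVfd, hφV, hVW, hVrot⟩ := hfin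
  haveI := hVfd
  have hV : V ≠ ⊥ := fun h => hφ0 (by rw [h] at hφV; exact (Submodule.mem_bot ℂ).1 hφV)
  obtain ⟨m, v, hvV, hv0, hv⟩ :=
    exists_isWeightVec_mem_of_finiteDimensional hV hVrot fun ψ hψ => hsmooth ψ (hVW hψ)
  have heven : Even m := even_of_isWeightVec hv (hpos v (hVW hvV)) hv0
  exact exists_isWeightVec_two_lowerFun_eq_zero hsmooth heps hlie hcas hrigid heven (hVW hvV) hv0 hv

/-- **`HasArchWeight m` for every `m` (PROVED)** — verbatim generalisation of
`GL2Real.hasArchWeight_one_of_isWeightVec` (`1 ↦ m`). -/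
theorem hasArchWeight_of_isWeightVec {j : GL (Fin 2) ℝ →* G} {ψ : G → ℂ}
    (hw : IsWeightVec (inclOf j) m ψ) (hs : IsArchSmooth (inclOf j) ψ)
    (hZ : lieDeriv (inclOf j) (toLie 1) ψ = 0) (a : G) :
    HasArchWeight m fun y => ψ (a * j y) := by
  refine hasArchWeight_of_rotGL_of_realScalarGL (fun g θ _ => ?_) (fun g r hr _ => ?_)
  · have h := hw (-θ) (a * j g)
    have hk : inclOf j (rotK (-θ)) = j (rotGL θ) := by
      change j (rotGL (-(-θ))) = _; rw [neg_neg]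
    rw [hk, mul_assoc, ← map_mul] at h
    change ψ (a * j (g * rotGL θ)) = ψ (a * j g) * _
    rw [h, ← Complex.exp_int_mul]
    push_cast
    ring_nf
  · rw [map_mul, ← mul_assoc]
    exact apply_mul_realScalarGL_of_lieDeriv_one hs hZ _ hr

/-- **P4a (S, sorried) — weight-`0` functions on `GL₂(ℝ)⁺` killed by `E₁₁`, `E₁₂` on the section
are constant.** `z ↦ F(g_z)` has real differential `y⁻¹((im ·)(E₁₁F)(g_τ) + (re ·)(E₁₂F)(g_τ)) = 0`
(`hasFDerivAt_comp_upperHalfPlaneToGL`) on the convex open upper half-plane, hence is constant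
(`Convex.is_const_of_fderivWithin_eq_zero` / `IsOpen.is_const_of_fderiv_eq_zero` on
`UpperHalfPlane`); `g = g_{g·i} κ` with `κ` in the stabiliser of `i`
(`exists_eq_realScalarGL_mul_rotGL`, `upperHalfPlaneToGL_smul_I`) and `HasArchWeight 0` removes
`κ` (`denom κ i ^ 0 · (√det κ) ^ 0 = 1`); `g_i = 1`. [cite: Bump1997, Prop. 2.2.5 (proof)] -/
theorem GL2Real.eq_apply_one_of_hasArchWeight_zero {F : GL (Fin 2) ℝ → ℂ} (hs : IsArchSmooth incl F)
    (hF : HasArchWeight 0 F)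
    (h₁₁ : ∀ τ : ℍ, lieDeriv incl (toLie e₁₁) F (upperHalfPlaneToGL τ) = 0)
    (h₁₂ : ∀ τ : ℍ, lieDeriv incl (toLie e₁₂) F (upperHalfPlaneToGL τ) = 0)
    {g : GL (Fin 2) ℝ} (hg : 0 < g.det.val) : F g = F 1 := by
  sorry

end Arch

/-! ## Adelic layer (`GL₂(𝔸_ℚ)`, Borel–Jacquet data) -/

variable {hcpt : isCompact_glFiniteIntegralLevel 2 ℚ}

/-- **P4b (S, sorried) — constants are not cuspidal**: a constant function in `cuspFormsGL 2 ℚ`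
vanishes (`cuspConditionGL_of_mem_cuspFormsGL` for the block `k = 1`:
`∫_{N(ℚ)\N(𝔸)} c = c · ν(𝓕) = 0` with `𝓕 = blockFundamentalDomain` of positive finite measure,
`isAddFundamentalDomain_blockFundamentalDomain`, `measure_blockFundamentalDomain_lt_top`).
[cite: BorelJacquetCorvallis1979, §4.4] -/
theorem eq_zero_of_const_mem_cuspFormsGL {c : ℂ}
    (h : (fun _ : (AdelicGroupData.gl 2 ℚ).Adelic => c) ∈ cuspFormsGL 2 ℚ hcpt) : c = 0 := by
  sorry

variable {π : AutomorphicRepData (AutomorphyDatum.gl 2 ℚ hcpt)}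

/-- **P4 (S/M, sorried) — rigidity of weight-zero vectors.** A `K₁(N)`-fixed form `ψ ∈ W`
(`W` cuspidal) of `SO(2)`-weight `0` killed by `X`, `X̄` and `Z` vanishes: all four `E_{ab} ψ = 0`
(`X + X̄ = 2h`, `X̄ - X = 2i(E₁₂ + E₂₁)`, `Z = E₁₁ + E₂₂`, `W = E₁₂ - E₂₁ = i·0` by
`IsWeightVec.lieDeriv_rotGen` at `m = 0`; `lieDeriv_smul_add_smul_of_isArchSmooth`), so every
pull-back `y ↦ ψ(a ι_𝔸 y)` is constant on `GL₂(ℝ)⁺` (P4a with `hasArchWeight_of_isWeightVec`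
(`m = 0`), `lieDeriv_inclOf_apply`, `isArchSmooth_incl_of_inclOf`); by `eq_of_invariant_of_ofRealGL`
(left `GL₂(ℚ)`-invariance `isAutomorphicForm_of_mem_W`, right `K₁(N)`-invariance) `ψ` is the
constant `ψ 1`, and constants are not cuspidal (P4b). [cite: Gelbart1975, p. 61]
[cite: Bump1997, Exercise 2.1.8] -/
theorem eq_zero_of_isWeightVec_zero (hcusp : π.W ≤ cuspFormsGL 2 ℚ hcpt) {N : ℕ} [NeZero N]
    {ψ : (AdelicGroupData.gl 2 ℚ).Adelic → ℂ} (hψ : ψ ∈ π.W)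
    (hfix : ∀ u ∈ gammaOneFiniteLevel ℚ (Ideal.span {(N : 𝓞 ℚ)}),
      rightTranslation (AdelicGroupData.gl 2 ℚ) (GLn.ofFinite 2 ℚ u) ψ = ψ)
    (hw : IsWeightVec Rat.iotaA 0 ψ) (hZ : lieDeriv Rat.iotaA (toLie 1) ψ = 0)
    (hL : lowerFun Rat.iotaA ψ = 0) (hR : raiseFun Rat.iotaA ψ = 0) : ψ = 0 := by
  sorry

/-- `1 ⊗ 1 = 1` under `X ↦ X ⊗ 1` (`Rat.lieOfReal`) — verbatim copy of `Rat.lieOfReal_one`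
(`AutomorphicRepsGL2WeightOneCleanModel`, not imported to keep the closure small). [folklore] -/
theorem Rat.lieOfReal_one_g4 : Rat.lieOfReal hcpt 1 = (⟨1, trivial⟩ : (AutomorphyDatum.gl 2 ℚ hcpt).arch.lie) :=
  Subtype.ext (Matrix.map_one _ (map_zero _) (map_one _))

/-- **P0 (PROVED) — the clean model at parameter `{s₁, s₂}` with `s₁ + s₂ = 0`** (port of
`IsOfWeightOne.exists_clean`: `exists_isShiftRealisation_of_sSup_irreducible`; the exponent `μ` of
the realisation is `s₁ + s₂ = 0` by `lieDeriv_one_sub_smul_mem` / `lieDeriv_one_eq_smul`, hence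
`A_G`-invariant forms; Satake parameters transfer). -/
theorem exists_clean_of_hasArchParameter {π : CuspidalAutomorphicRepData 2 ℚ hcpt} {s₁ s₂ : ℂ}
    (hpar : π.1.HasArchParameter fun _ => ({s₁, s₂} : Multiset ℂ)) (hsum : s₁ + s₂ = 0) :
    ∃ π₀ : CuspidalAutomorphicRepData 2 ℚ hcpt, π₀.1.W' = ⊥ ∧
      π₀.1.HasArchParameter (fun _ => ({s₁, s₂} : Multiset ℂ)) ∧ π₀.1.W ≤ π.1.W ∧
      (∀ φ ∈ π₀.1.W, ∀ z ∈ (AdelicGroupData.gl 2 ℚ).center', ∀ g, φ (z * g) = φ g) ∧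
      ∀ (v : HeightOneSpectrum (𝓞 ℚ)) (β : Multiset ℂ),
        π₀.1.HasSatakeParamAt v β → π.1.HasSatakeParamAt v β := by
  obtain ⟨π₀, μ, j, M, h⟩ :=
    π.exists_isShiftRealisation_of_sSup_irreducible AutomorphicRepsGL.stable_cuspidal_eq_sSup_irreducible_holds
  have h₀ : π₀.1.HasArchParameter (fun _ => ({s₁, s₂} : Multiset ℂ)) := h.hasArchParameter hpar
  have hμ : μ = 0 := by
    obtain ⟨c, hcW, hc0⟩ := Submodule.exists_mem_ne_zero_of_ne_bot h.W_ne_bot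
    have h1 := π₀.1.lieDeriv_one_sub_smul_mem h₀ hcW
    rw [hsum, zero_smul, sub_zero, ← Rat.lieDeriv_ofArch_lieOfReal_eq (hcpt := hcpt), Rat.lieOfReal_one_g4,
      h.lieDeriv_one_eq_smul hcW, h.bot, Submodule.mem_bot] at h1
    rcases smul_eq_zero.1 h1 with h2 | h2
    · exact h2
    · exact absurd h2 hc0
  exact ⟨π₀, h.bot, h₀, h.le, fun φ hφ => h.apply_center'_mul hμ hφ, fun v β hβ => h.hasSatakeParamAt hβ⟩

/-- **Weight zero for `GL₂/ℚ` is the Harish-Chandra parameter `{1/2, -1/2}`** (PROVED,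
`map_a_weightZeroInfinityType_two`). -/
theorem HasWeightZero.hasArchParameter_weightTwo (h : π.HasWeightZero) :
    π.HasArchParameter fun _ => ({sOne, sTwo} : Multiset ℂ) := by
  have h2 : π.HasArchParameter fun σ => (weightZeroInfinityType 2 ℚ σ).map ArchWeight.a := h.2
  have e : (fun σ : ℚ →+* ℂ => (weightZeroInfinityType 2 ℚ σ).map ArchWeight.a) =
      fun _ => ({sOne, sTwo} : Multiset ℂ) := by
    funext σ
    rw [map_a_weightZeroInfinityType_two]
    rfl
  rwa [e] at h2

/-- `(√n)² z = n`, `n ≠ 0` ⇒ `z = 1`. PROVED. -/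
theorem eq_one_of_sqrt_sq_mul_eq {n : ℕ} (hn : n ≠ 0) {z : ℂ}
    (h : ((Real.sqrt n : ℝ) : ℂ) ^ 2 * z = (n : ℂ)) : z = 1 := by
  have hq : ((Real.sqrt n : ℝ) : ℂ) ^ 2 = (n : ℂ) := by
    rw [← Complex.ofReal_pow, Real.sq_sqrt (Nat.cast_nonneg _), Complex.ofReal_natCast]
  rw [hq] at h
  have hn' : (n : ℂ) ≠ 0 := by exact_mod_cast hn
  exact (mul_right_inj' hn').1 (h.trans (mul_one _).symm)

/-- **P1 (PROVED) — the Satake feed on the clean model, cofinitely.** If `π` has Hecke polynomial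
`X² - a_w(E) X + q_w` at every `w ∤ Δ(E)` (`Δ(E) ≠ 0`) and the Satake parameters of `π₀` are Satake
parameters of `π`, then at cofinitely many `v`, `π₀` has a Satake parameter `α` with `∏ α = 1` and
`q_v^{1/2} Σ α = a_v(E)` (`hasSatakeParamAt_cofinite_holds π₀`, `hasSatakeParamAt_unique_holds π`,
`exists_hasSatakeParamAt_of_hasHeckePolynomialAt_frobPoly`, `eventually_not_mem_asIdeal`). -/
theorem eventually_hasSatakeParamAt_prod_eq_one {E : WeierstrassCurve (𝓞 ℚ)} (hΔ : E.Δ ≠ 0)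
    {π π₀ : CuspidalAutomorphicRepData 2 ℚ hcpt}
    (hH : ∀ w : HeightOneSpectrum (𝓞 ℚ), E.Δ ∉ w.asIdeal →
      π.1.HasHeckePolynomialAt w ((frobPoly (frobTraceAt E w) w.residueCard).map (Int.castRingHom ℂ)))
    (hsat : ∀ (v : HeightOneSpectrum (𝓞 ℚ)) (β : Multiset ℂ),
      π₀.1.HasSatakeParamAt v β → π.1.HasSatakeParamAt v β) :
    ∀ᶠ v : HeightOneSpectrum (𝓞 ℚ) in cofinite, ∃ α : Multiset ℂ, π₀.1.HasSatakeParamAt v α ∧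
      α.prod = 1 ∧ ((Real.sqrt v.residueCard : ℝ) : ℂ) * α.sum = (frobTraceAt E v : ℂ) := by
  have hc : ∀ᶠ v : HeightOneSpectrum (𝓞 ℚ) in cofinite, π₀.1.IsUnramifiedAt v :=
    π₀.1.hasSatakeParamAt_cofinite_holds
  filter_upwards [eventually_not_mem_asIdeal hΔ, hc] with v hv hur
  obtain ⟨β, hβ⟩ := hur
  obtain ⟨α, hα, hsum, hprod⟩ := exists_hasSatakeParamAt_of_hasHeckePolynomialAt_frobPoly (hH v hv)
  have hαβ : β = α := π.1.hasSatakeParamAt_unique_holds (hsat v β hβ) hα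
  subst hαβ
  have hn : v.residueCard ≠ 0 := by
    rw [Rat.residueCard_eq_natGenerator]; exact (prime_natGenerator v).ne_zero
  exact ⟨β, hβ, eq_one_of_sqrt_sq_mul_eq hn hprod, hsum⟩

/-- `ofArch (-1) = (-1)_∞ · 1₂` in `GL₂(𝔸_ℚ)` — verbatim copy of the tree lemma
`ofArch_neg_one_eq_scalar_infIdele` (`StrongArtinCentralCharacter`, not imported here to keep the
import closure small). [folklore] -/
theorem ofArch_neg_one_eq_scalar_infIdele' :
    (AutomorphyDatum.gl 2 ℚ hcpt).ofArch ⟨-1, trivial⟩ =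
      (show (AdelicGroupData.gl 2 ℚ).Adelic from
        Matrix.GeneralLinearGroup.scalar (Fin 2) (Rat.infIdele (-1) : ideleGroup ℚ)) := by
  open NumberField.mixedEmbedding in
  refine Matrix.GeneralLinearGroup.ext fun i j => ?_
  rw [AutomorphyDatum.gl_ofArch_apply, GLn.coe_ofInfinite_apply]
  change ((InfiniteAdeleRing.ringEquiv_mixedSpace ℚ).symm (((-1 : GL (Fin 2) (mixedSpace ℚ)) :
      Matrix (Fin 2) (Fin 2) (mixedSpace ℚ)) i j), (1 : Matrix (Fin 2) (Fin 2) (FiniteAdeleRing (𝓞 ℚ) ℚ)) i j) =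
    ((Matrix.GeneralLinearGroup.scalar (Fin 2) (Rat.infIdele (-1) : ideleGroup ℚ) :
      GL (Fin 2) (AdeleRing (𝓞 ℚ) ℚ)) : Matrix (Fin 2) (Fin 2) (AdeleRing (𝓞 ℚ) ℚ)) i j
  rw [Matrix.GeneralLinearGroup.coe_scalar, Matrix.scalar_apply, Matrix.diagonal_apply, Units.val_neg, Units.val_one,
    Matrix.neg_apply, Matrix.one_apply, Matrix.one_apply]
  by_cases hij : i = j
  · rw [if_pos hij, if_pos hij, if_pos hij, map_neg, map_one]
    refine Prod.ext ?_ ?_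
    · change (-1 : InfiniteAdeleRing ℚ) = ((Rat.infIdele (-1) : ideleGroup ℚ) : AdeleRing (𝓞 ℚ) ℚ).1
      funext w
      rw [Rat.infIdele_fst_apply, Units.val_neg, Units.val_one, map_neg, map_one]
      rfl
    · rfl
  · rw [if_neg hij, if_neg hij, if_neg hij, neg_zero, map_zero]
    rfl

/-- **P2 (PROVED) — EVEN SIGN from the central character.** If `π = W/⊥` has, at cofinitely many
places, a Satake parameter with `∏ α = 1`, then the archimedean `-1` acts trivially on `W`: the
central character `ω = ω_π` (`exists_centralCharacter`: `r(z·1₂) φ = ω(z) φ` on `W` as `W' = ⊥`,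
and `ω(ϖ_v) = ∏ α`) has `ω(ϖ_v) = 1` cofinitely, so `ω = 1`
(`HeckeCharacter.eq_one_of_eventually_valueAtUniformizer_eq_one`), and `(-1)_∞ = (-1)_∞ · 1₂`
(`ofArch_neg_one_eq_scalar_infIdele`, copied here as `…'`). Replaces the odd sign `IsOfWeightOne.2`.
[cite: Gelbart1997, §7.1 (a)] -/
theorem rightTranslation_ofArch_neg_one_eq_self (hbot : π.W' = ⊥)
    (h1 : ∀ᶠ v : HeightOneSpectrum (𝓞 ℚ) in cofinite, ∃ α : Multiset ℂ, π.HasSatakeParamAt v α ∧ α.prod = 1)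
    {φ : (AdelicGroupData.gl 2 ℚ).Adelic → ℂ} (hφ : φ ∈ π.W) :
    rightTranslation (AdelicGroupData.gl 2 ℚ) ((AutomorphyDatum.gl 2 ℚ hcpt).ofArch ⟨-1, trivial⟩) φ = φ := by
  obtain ⟨ω, hω, hωv⟩ := π.exists_centralCharacter
  have hω1 : ω = 1 := by
    refine HeckeCharacter.eq_one_of_eventually_valueAtUniformizer_eq_one (h1.mono ?_)
    rintro v ⟨α, hα, hprod⟩
    rw [(hωv hα).2, hprod]
  have h := hω (Rat.infIdele (-1)) φ hφ
  rw [hbot, Submodule.mem_bot, sub_eq_zero, hω1] at h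
  simp only [HeckeCharacter.one_apply, Units.val_one, one_smul] at h
  rw [ofArch_neg_one_eq_scalar_infIdele']
  exact h

/-- **P2′ (PROVED)** — the same read along `ι_𝔸`: `φ(g · ι_𝔸(k_π)) = φ(g)` (`Rat.iotaA_rotK_pi`). -/
theorem apply_mul_iotaA_rotK_pi_eq_self (hbot : π.W' = ⊥)
    (h1 : ∀ᶠ v : HeightOneSpectrum (𝓞 ℚ) in cofinite, ∃ α : Multiset ℂ, π.HasSatakeParamAt v α ∧ α.prod = 1)
    {φ : (AdelicGroupData.gl 2 ℚ).Adelic → ℂ} (hφ : φ ∈ π.W) (g : (AdelicGroupData.gl 2 ℚ).Adelic) :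
    φ (g * Rat.iotaA (rotK Real.pi)) = φ g := by
  have h := congrFun (rightTranslation_ofArch_neg_one_eq_self hbot h1 hφ) g
  rw [rightTranslation_apply, ← Rat.iotaA_rotK_pi (hcpt := hcpt)] at h
  exact h

/-- **P3-adelic (PROVED modulo nothing: uses P3) — a weight-TWO vector killed by `X` and `Z` in
every stable `W₁ ≤ W`** (port of `exists_isWeightVec_one_of_isOfWeightOne`): parameter
`{1/2,-1/2}` gives `Z = 0` and `C = s₁² + s₂² - ½ = 0` exactly on `W` (`lieDeriv_one_sub_smul_mem`,
`sum_lieDeriv_single_sub_smul_mem`, `W' = ⊥`), so `Ω = C - ½ Z² = 0`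
(`GL2Real.casimirFun_add_half_zz`); even sign `hpos`; rigidity `hrigid`; `K_∞`-finiteness
`exists_finiteDimensional_rotation_span`. -/
theorem exists_isWeightVec_two_of_hasArchParameter (hbot : π.W' = ⊥)
    (hpar : π.HasArchParameter fun _ => ({sOne, sTwo} : Multiset ℂ))
    (hpos : ∀ φ ∈ π.W, ∀ g, φ (g * Rat.iotaA (rotK Real.pi)) = φ g)
    {W₁ : Submodule ℂ ((AdelicGroupData.gl 2 ℚ).Adelic → ℂ)} (hW₁ : W₁ ≤ π.W)
    (heps : ∀ φ ∈ W₁, archTranslate Rat.iotaA epsK φ ∈ W₁)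
    (hrot : ∀ θ : ℝ, ∀ φ ∈ W₁, archTranslate Rat.iotaA (rotK θ) φ ∈ W₁)
    (hlie : ∀ (X : Matrix (Fin 2) (Fin 2) ℝ), ∀ φ ∈ W₁, lieDeriv Rat.iotaA (toLie X) φ ∈ W₁)
    (hrigid : ∀ φ ∈ W₁, IsWeightVec Rat.iotaA 0 φ → lieDeriv Rat.iotaA (toLie 1) φ = 0 →
      lowerFun Rat.iotaA φ = 0 → raiseFun Rat.iotaA φ = 0 → φ = 0)
    {φ : (AdelicGroupData.gl 2 ℚ).Adelic → ℂ} (hφ : φ ∈ W₁) (hφ0 : φ ≠ 0) :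
    ∃ ψ ∈ W₁, ψ ≠ 0 ∧ IsWeightVec Rat.iotaA 2 ψ ∧ lowerFun Rat.iotaA ψ = 0 ∧
      lieDeriv Rat.iotaA (toLie 1) ψ = 0 := by
  have hsmooth : ∀ ψ ∈ W₁, IsArchSmooth Rat.iotaA ψ := fun ψ hψ =>
    (π.isArchSmooth_of_mem_W (hW₁ hψ)).iotaA
  have hZ : ∀ ψ ∈ π.W, lieDeriv Rat.iotaA (toLie 1) ψ = 0 := fun ψ hψ => by
    have h := π.lieDeriv_one_sub_smul_mem hpar hψ
    rw [hbot, Submodule.mem_bot, sOne_add_sTwo, zero_smul, sub_zero] at h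
    exact h
  have hcas : ∀ ψ ∈ W₁, casimirFun Rat.iotaA ψ = (0 : ℂ) • ψ := fun ψ hψ => by
    have h := π.sum_lieDeriv_single_sub_smul_mem hpar (hW₁ hψ)
    rw [hbot, Submodule.mem_bot, sub_eq_zero] at h
    have hid := GL2Real.casimirFun_add_half_zz (hsmooth ψ hψ)
    rw [hZ ψ (hW₁ hψ), lieDeriv_zero_right, smul_zero, add_zero] at hid
    rw [hid, h, sOne_sq_add_sTwo_sq]
  obtain ⟨ψ, hψW, hψ0, hw, hL⟩ := exists_isWeightVec_two_lowerFun_eq_zero_of_finite hsmooth heps hlie hcas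
    (fun ψ hψ g => hpos ψ (hW₁ hψ) g)
    (fun ψ hψ hw0 hL0 hR0 => hrigid ψ hψ hw0 (hZ ψ (hW₁ hψ)) hL0 hR0) hφ0
    (π.exists_finiteDimensional_rotation_span hW₁ hrot hφ)
  exact ⟨ψ, hψW, hψ0, hw, hL, hZ ψ (hW₁ hψW)⟩

/-! ## Finite-adelic layer: the three `k = 2` Hecke ports (Gelbart 1975, Lemma 3.7; Kudla (4.6)–(4.7)) -/

/-- **P5a (M, sorried) — `φ_f ∈ W` (`W' = ⊥`) makes `f ∈ S₂(Γ₁(N))` a `T_p`- and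
`⟨p⟩`-eigenvector for `p ∤ N`** (port of `exists_heckeT_eq_smul_of_adelicLiftFunA_mem`, `1 ↦ 2`:
the `K(N)`-Hecke operators act on `K(N)`-fixed vectors of `W` by scalars,
`Flath1979_heckeOperator_ofLocal_sub_smul_mem_holds`; `T_{p,1} φ_f = φ_{T_p f}` at `k = 2`
(`heckeOperator_principalCongruenceLevel_adelicLiftFunA_one`, factor `((√p)^(k-2))⁻¹ = 1`) and
`T_{p,2} φ_f = φ_{⟨p⟩ f}` (`…_two`); `f ↦ φ_f` detects scalars,
`CuspForm.eq_of_adelicLiftFun_ofRealGL_eq`). [cite: Gelbart1975, Lemma 3.7] -/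
theorem exists_heckeT_eq_smul_of_adelicLiftFunA_mem_two (hbot : π.W' = ⊥) {N : ℕ} [NeZero N]
    (f : CuspForm (Gamma1 N) 2) (hfW : adelicLiftFunA N 2 f ∈ π.W) {v : HeightOneSpectrum (𝓞 ℚ)}
    (hv : ¬ v.asIdeal ∣ Ideal.span {(N : 𝓞 ℚ)}) :
    ∃ a e : ℂ, Literature.NumberTheory.EllipticCurves.ModularForms.heckeT (Gamma1 N) 2 (natGenerator v) f = a • f ∧
      diamondOp N 2 ((natGenerator v : ℕ) : ZMod N) f = e • f ∧
      heckeOperator (rightTranslation (AdelicGroupData.gl 2 ℚ))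
          (show Subgroup (AdelicGroupData.gl 2 ℚ).Adelic from principalCongruenceLevel 2 ℚ (Ideal.span {(N : 𝓞 ℚ)}))
          (heckeDiagAt 2 ℚ v (Rat.localUniformizer v) 1) (adelicLiftFunA N 2 f) = a • adelicLiftFunA N 2 f ∧
      heckeOperator (rightTranslation (AdelicGroupData.gl 2 ℚ))
          (show Subgroup (AdelicGroupData.gl 2 ℚ).Adelic from principalCongruenceLevel 2 ℚ (Ideal.span {(N : 𝓞 ℚ)}))
          (heckeDiagAt 2 ℚ v (Rat.localUniformizer v) 2) (adelicLiftFunA N 2 f) = e • adelicLiftFunA N 2 f := by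
  sorry

/-- **P5b (S, sorried) — nebentypus** (port of `exists_mem_nebentypusSubspace_of_adelicLiftFunA_mem`:
Dirichlet `Nat.forall_exists_prime_gt_and_eq_mod` + `diamondOp_mul_holds`; uses P5a).
[cite: DiamondShurman2005, §5.2 p. 169] -/
theorem exists_mem_nebentypusSubspace_of_adelicLiftFunA_mem_two (hbot : π.W' = ⊥) {N : ℕ} [NeZero N]
    {f : CuspForm (Gamma1 N) 2} (hf0 : f ≠ 0) (hfW : adelicLiftFunA N 2 f ∈ π.W) :
    ∃ χ : DirichletCharacter ℂ N, f ∈ nebentypusSubspace N 2 χ := by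
  sorry

/-- **P5c (S/M, sorried) — the Satake parameter at `p ∤ N` read off `T_p f = a f`, `⟨p⟩ f = e f`,
`k = 2`** (port of `hasSatakeParamAt_of_adelicLiftFunA_mem`; normalisation `q^{i(2-i)/2} e_i(α)` of
`HasSatakeParamAt`: `√p e₁(α) = a`, `e₂(α) = e`). [cite: KudlaLanglandsProgram, (4.6)–(4.7)]
[cite: Gelbart1997, (2.5.1)] -/
theorem hasSatakeParamAt_of_adelicLiftFunA_mem_two (hbot : π.W' = ⊥) {N : ℕ} [NeZero N]
    {f : CuspForm (Gamma1 N) 2} (hf0 : f ≠ 0) (hfW : adelicLiftFunA N 2 f ∈ π.W)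
    {v : HeightOneSpectrum (𝓞 ℚ)} (hv : ¬ v.asIdeal ∣ Ideal.span {(N : 𝓞 ℚ)}) {a e : ℂ}
    (hT : Literature.NumberTheory.EllipticCurves.ModularForms.heckeT (Gamma1 N) 2 (natGenerator v) f = a • f)
    (hD : diamondOp N 2 ((natGenerator v : ℕ) : ZMod N) f = e • f) :
    ∃ α : Multiset ℂ, π.HasSatakeParamAt v α ∧
      ((Real.sqrt (natGenerator v) : ℝ) : ℂ) * α.sum = a ∧ α.prod = e := by
  sorry

/-! ## Descent and the newform -/

/-- **P6 (M, sorried) — a `K₁(N)`-fixed vector of a clean weight-two `π` yields `f ∈ S₂(Γ₁(N))`,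
`f ≠ 0`, with `φ_f ∈ W`** (port of `IsOfWeightOne.exists_cuspForm_of_fixed`, `1 ↦ 2`: the stable
subspace `W₁ = W ∩ Fix K₁(N)` (`Rat.ofRealGL_mul_ofFinite_comm`), P3-adelic with `hrigid` := P4 on
`W₁`, Gelbart's (2.5.4) via `hasArchWeight_of_isWeightVec` (`m = 2`), `isArchSmooth_incl_of_inclOf`,
`lowering_eq_zero_of_lowerFun_eq_zero`, `cuspidal_bounded_holds`, and
`adelicDescentCuspForm N 2 two_pos` / `adelicLiftFun_adelicDescentCuspForm`).
[cite: Gelbart1997, (2.5.4) and Prop. 2.5] -/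
theorem exists_cuspForm_two_of_fixed (hbot : π.W' = ⊥)
    (hpar : π.HasArchParameter fun _ => ({sOne, sTwo} : Multiset ℂ))
    (hpos : ∀ φ ∈ π.W, ∀ g, φ (g * Rat.iotaA (rotK Real.pi)) = φ g)
    (hcusp : π.W ≤ cuspFormsGL 2 ℚ hcpt)
    (hAG : ∀ φ ∈ π.W, ∀ z ∈ (AdelicGroupData.gl 2 ℚ).center', ∀ g, φ (z * g) = φ g)
    {N : ℕ} [NeZero N] {φ : (AdelicGroupData.gl 2 ℚ).Adelic → ℂ} (hφ : φ ∈ π.W) (hφ0 : φ ≠ 0)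
    (hfix : ∀ u ∈ gammaOneFiniteLevel ℚ (Ideal.span {(N : 𝓞 ℚ)}),
      rightTranslation (AdelicGroupData.gl 2 ℚ) (GLn.ofFinite 2 ℚ u) φ = φ) :
    ∃ ψ ∈ π.W, ψ ≠ 0 ∧
      (∀ u ∈ gammaOneFiniteLevel ℚ (Ideal.span {(N : 𝓞 ℚ)}),
        rightTranslation (AdelicGroupData.gl 2 ℚ) (GLn.ofFinite 2 ℚ u) ψ = ψ) ∧
      IsWeightVec Rat.iotaA 2 ψ ∧ lowerFun Rat.iotaA ψ = 0 ∧ lieDeriv Rat.iotaA (toLie 1) ψ = 0 ∧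
      ∃ f : CuspForm (Gamma1 N) 2,
        adelicLiftFun N 2 f = (show GL (Fin 2) (AdeleRing (𝓞 ℚ) ℚ) → ℂ from ψ) ∧ f ≠ 0 := by
  sorry

/-- **P7 (M, sorried) — the newform of minimal level** (port of
`IsOfWeightOne.exists_isNewform1_of_fixed`, `1 ↦ 2`: least level `N₀` with a `K₁(N₀)`-fixed vector
(`Nat.find`), P6, newness by minimality `mem_newSubspace1_of_forall_fixed`, eigen-data P5a/P5b,
Atkin–Lehner–Li `exists_isNewform1_of_mem_newSubspace1 (atkinLehnerMainLemma1_holds N₀ 2)`, and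
`φ_f = c⁻¹ φ_{f₀} ∈ W` by `eq_of_invariant_of_ofRealGL` / `adelicLiftFun_coe_smul_ofRealGL`).
[cite: Gelbart1975, Thm. 5.19] [cite: DiamondShurman2005, Thm. 5.8.2] -/
theorem exists_isNewform1_two_of_fixed (hbot : π.W' = ⊥)
    (hpar : π.HasArchParameter fun _ => ({sOne, sTwo} : Multiset ℂ))
    (hpos : ∀ φ ∈ π.W, ∀ g, φ (g * Rat.iotaA (rotK Real.pi)) = φ g)
    (hcusp : π.W ≤ cuspFormsGL 2 ℚ hcpt)
    (hAG : ∀ φ ∈ π.W, ∀ z ∈ (AdelicGroupData.gl 2 ℚ).center', ∀ g, φ (z * g) = φ g)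
    {N : ℕ} [NeZero N] {φ : (AdelicGroupData.gl 2 ℚ).Adelic → ℂ} (hφ : φ ∈ π.W) (hφ0 : φ ≠ 0)
    (hfix : ∀ u ∈ gammaOneFiniteLevel ℚ (Ideal.span {(N : 𝓞 ℚ)}),
      rightTranslation (AdelicGroupData.gl 2 ℚ) (GLn.ofFinite 2 ℚ u) φ = φ) :
    ∃ (N₀ : ℕ) (_ : NeZero N₀) (f : CuspForm (Gamma1 N₀) 2), IsNewform1 f ∧ adelicLiftFunA N₀ 2 f ∈ π.W := by
  sorry

/-- **P8 (S/M, sorried) — trivial nebentypus, `Γ₀`-descent and the `a_p`.** If `f ∈ S₂(Γ₁(N₀))` is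
a newform with `φ_f ∈ W` (`W' = ⊥`) and every Satake parameter `α_v` of `π` at `v` with `p_v ∤ R`
(`R ≥ 1`) has `∏ α_v = 1`, `√p_v Σ α_v = a v`, then `f = liftToGamma1 g` for a newform
`g ∈ S₂(Γ₀(N₀))` with `a_{p_v}(g) = a v` whenever `p_v ∤ N₀ R`: by P5a–P5c, `⟨p⟩ f = f` and
`T_p f = a(v_p) f` for all primes `p ∤ N₀ R`, so the nebentypus (P5b) is trivial (Dirichlet: every
unit mod `N₀` is such a prime, `Nat.forall_exists_prime_gt_and_eq_mod`);
`MurtySinha.exists_liftToGamma1_eq_of_mem_nebentypusSubspace_one`, `isNewform1_liftToGamma1_iff_holds`,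
`IsNewform0.heckeT_eq_coeff_smul` with `heckeT_liftToGamma1`, `cuspCoeff_liftToGamma1_eq`.
[cite: DiamondShurman2005, Prop. 5.8.5] [cite: AtkinLehner1970, Thm. 3] -/
theorem exists_isNewform0_of_isNewform1_two (hbot : π.W' = ⊥) {N₀ : ℕ} [NeZero N₀]
    {f : CuspForm (Gamma1 N₀) 2} (hf : IsNewform1 f) (hfW : adelicLiftFunA N₀ 2 f ∈ π.W)
    {R : ℕ} (hR : R ≠ 0) (a : HeightOneSpectrum (𝓞 ℚ) → ℂ)
    (hα : ∀ v : HeightOneSpectrum (𝓞 ℚ), ¬ natGenerator v ∣ R → ∀ α : Multiset ℂ,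
      π.HasSatakeParamAt v α → α.prod = 1 ∧ ((Real.sqrt (natGenerator v) : ℝ) : ℂ) * α.sum = a v) :
    ∃ g : CuspForm (Gamma0 N₀) 2, IsNewform0 g ∧ liftToGamma1 N₀ 2 g = f ∧
      ∀ v : HeightOneSpectrum (𝓞 ℚ), ¬ natGenerator v ∣ N₀ * R → cuspCoeff g (natGenerator v) = a v := by
  sorry

/-- **P9 (PROVED) — the exceptional modulus `R = |Δ(E)|` and `a_w(E) = a_p(E ⊗ ℚ)` at `p ∤ R`**
(`Rat.intCast_mem_asIdeal_iff`, `lFunction_primesEquiv_eq_frobeniusTraceAt`,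
`hasGoodReductionAt_baseChange_of_Δ_not_mem`, `frobeniusTraceAt_baseChange_eq_frobTraceAt`). -/
theorem exists_R_lFunction_eq_frobTraceAt {E : WeierstrassCurve (𝓞 ℚ)} (hΔ : E.Δ ≠ 0) :
    ∃ R : ℕ, R ≠ 0 ∧ ∀ v : HeightOneSpectrum (𝓞 ℚ), ¬ natGenerator v ∣ R →
      E.Δ ∉ v.asIdeal ∧
      ((E.baseChange ℚ).LFunction (natGenerator v) : ℂ) = (frobTraceAt E v : ℂ) := by
  have hzΔ : (((Rat.ringOfIntegersEquiv E.Δ : ℤ)) : 𝓞 ℚ) = E.Δ := by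
    rw [← eq_intCast Rat.ringOfIntegersEquiv.symm, RingEquiv.symm_apply_apply]
  have hz0 : (Rat.ringOfIntegersEquiv E.Δ : ℤ) ≠ 0 := fun h => hΔ (by rw [← hzΔ, h, Int.cast_zero])
  refine ⟨(Rat.ringOfIntegersEquiv E.Δ : ℤ).natAbs, Int.natAbs_ne_zero.2 hz0, fun v hv => ?_⟩
  have hΔv : E.Δ ∉ v.asIdeal := fun hmem => hv (by
    rw [← hzΔ, Rat.intCast_mem_asIdeal_iff] at hmem
    exact Int.ofNat_dvd_left.1 hmem)
  refine ⟨hΔv, ?_⟩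
  have h1 := WeierstrassCurve.lFunction_primesEquiv_eq_frobeniusTraceAt (E.baseChange ℚ)
    (hasGoodReductionAt_baseChange_of_Δ_not_mem hΔv)
  have h2 : ((primesEquiv v : Nat.Primes) : ℕ) = natGenerator v := rfl
  rw [h2, frobeniusTraceAt_baseChange_eq_frobTraceAt hΔv] at h1
  rw [h1]

/-! ## Composition: D4a from the helpers (kernel-checked) -/

/-- **D4a from P0–P9 (PROVED modulo the sorried ports P4·, P5·, P6, P7, P8).** Clean model `π₀`
of the given weight-zero `π` (P0 at `{1/2,-1/2}`, `HasWeightZero.hasArchParameter_weightTwo`);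
Satake feed (P1) ⇒ even sign (P2′); new vector
(`CuspidalAutomorphicRepData.exists_gammaOneFiniteLevel_fixed`, PROVED in the tree); newform
`f ∈ S₂(Γ₁(N₀))` with `φ_f ∈ C` (P7); the feed at EVERY `v` with `p_v ∤ R` by uniqueness of the
Satake parameters of `π` (`hasSatakeParamAt_unique_holds`) and P9; `Γ₀`-newform `g` with
`a_p(g) = a_{v_p}(E)` off `N₀ R` (P8); `a_{v_p}(E) = a_p(E ⊗ ℚ)` (P9). -/
theorem D4a_of_helpers : D4a := by
  intro E hΔ hE
  obtain ⟨hL, π, h0, hH⟩ := hE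
  -- P0: the clean model at `{1/2, -1/2}`
  obtain ⟨π₀, hbot, hpar₀, hle, hAG, hsat⟩ :=
    exists_clean_of_hasArchParameter (HasWeightZero.hasArchParameter_weightTwo h0) sOne_add_sTwo
  -- P1 + P2′: even sign on the clean model
  have hfeed := eventually_hasSatakeParamAt_prod_eq_one hΔ hH hsat
  have hpos : ∀ φ ∈ π₀.1.W, ∀ g, φ (g * Rat.iotaA (rotK Real.pi)) = φ g := fun φ hφ g =>
    apply_mul_iotaA_rotK_pi_eq_self hbot
      (hfeed.mono fun v hv => by obtain ⟨α, hα, hprod, -⟩ := hv; exact ⟨α, hα, hprod⟩) hφ g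
  -- Casselman's new vector (PROVED in the tree)
  obtain ⟨N, hN, φ, hφ, hφ0, hfix⟩ := π₀.exists_gammaOneFiniteLevel_fixed
  -- P7: newform of minimal level with `φ_f ∈ C`
  obtain ⟨N₀, hN₀, f, hf, hfW⟩ :=
    exists_isNewform1_two_of_fixed hbot hpar₀ hpos π₀.2 hAG hφ hφ0 hfix
  -- P9: the exceptional modulus and `a_w(E) = a_p(E ⊗ ℚ)`
  obtain ⟨R, hR0, hR⟩ := exists_R_lFunction_eq_frobTraceAt hΔ
  -- the feed at every `v` with `p_v ∤ R`, by uniqueness of Satake parameters of `π`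
  have hfeedR : ∀ v : HeightOneSpectrum (𝓞 ℚ), ¬ natGenerator v ∣ R → ∀ α : Multiset ℂ,
      π₀.1.HasSatakeParamAt v α → α.prod = 1 ∧
        ((Real.sqrt (natGenerator v) : ℝ) : ℂ) * α.sum = (frobTraceAt E v : ℂ) := by
    intro v hvR α hα
    obtain ⟨hΔv, -⟩ := hR v hvR
    obtain ⟨β, hβ, hsum, hprod⟩ := exists_hasSatakeParamAt_of_hasHeckePolynomialAt_frobPoly (hH v hΔv)
    have hαβ : α = β := π.1.hasSatakeParamAt_unique_holds (hsat v α hα) hβ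
    subst hαβ
    rw [Rat.residueCard_eq_natGenerator] at hsum hprod
    exact ⟨eq_one_of_sqrt_sq_mul_eq (prime_natGenerator v).ne_zero hprod, hsum⟩
  -- P8: `Γ₀`-descent and the `a_p`
  obtain ⟨g, hg, -, hcoef⟩ :=
    exists_isNewform0_of_isNewform1_two hbot hf hfW hR0 (fun v => (frobTraceAt E v : ℂ)) hfeedR
  refine ⟨N₀, hN₀, g, hg, R, ⟨hR0⟩, fun q hq hqMR => ?_⟩
  set v : HeightOneSpectrum (𝓞 ℚ) := (primesEquiv (R := 𝓞 ℚ)).symm ⟨q, hq⟩ with hv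
  have hqv : natGenerator v = q :=
    congrArg Subtype.val ((primesEquiv (R := 𝓞 ℚ)).apply_symm_apply ⟨q, hq⟩)
  have hvR : ¬ natGenerator v ∣ R := fun h => hqMR (hqv ▸ dvd_mul_of_dvd_right h N₀)
  have hvNR : ¬ natGenerator v ∣ N₀ * R := by rw [hqv]; exact hqMR
  have h1 := hcoef v hvNR
  obtain ⟨-, h2⟩ := hR v hvR
  rw [hqv] at h1 h2
  rw [h1, h2]

end Summit.ABC.ABC.Cruxes.FreyModularity.StubIdeas.LiftFive2g4

end
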